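/-
Copyright (c) 2026 the pub-hodgecm-mathlib formalisation cell (harness21).  Prover seat hodgecm-mathlib-K2E5-p17 (g9), Track B «K2-LIT»,
#184♮ = hLiu418 = `stmt-HodgeConjecture-24832`; socket #41 — THE TOP, edition 20, SOCKET-FORM TWIN of ★ `…TopTwenty.siegelEisensteinContinuation_twenty_poleSet`: the same by-value
surface, conclusion = socket #41's body BYTES VERBATIM, two-line corollary (separate file by the 400-line rule).  THEOREMS ONLY; NO `Lines` import.
-/
import Summits.HodgeConjecture.HodgeConjecture.Theorems.K2LiuSiegelEisensteinContinuationTopTwenty   -- ★ ED. 20 pinned head `siegelEisensteinContinuation_twenty_poleSet` (this seat)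
import HarnessLib

/-!
# Crux `HLiu418`, socket #41 — THE TOP, edition 20, SOCKET FORM: `∃ P Es, (A1) ∧ … ∧ (A5)` (socket #41's body verbatim) from the pinned head of ★ `…TopTwenty` at `P := {½}`

Cell `hodgecm-mathlib`, crux item hLiu418 = `stmt-HodgeConjecture-24832` (helper lane until the typist's tie; count-neutral).

The by-value surface is ★ ED. 20's VERBATIM (socket prefix; carrier; `wq hwq`; `{S} hS hur hram hArch`; `hadapt`; K1-b♮; K1-a♮; KW — 54 slots in K2E3-typ2's count); the conclusion is
socket #41 `sig_K2LiuSiegelEisensteinContinuation`'s body (U6 :296–306) BYTES VERBATIM; the proof is `⟨{½}, Es, …⟩` over ★ `siegelEisensteinContinuation_twenty_poleSet`.  This is the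
END HEAD the socket tie `exact`s; the pinned twin is what the HOL-½′ payer of #42F′ consumes.
HONEST LABEL.  Count-neutral helper until tied; `HC_CM` is proved only modulo the 7 printed citations (2 remaining named inputs: hLiu418 = `stmt-HodgeConjecture-24832`,
h413 = `stmt-HodgeConjecture-24833`) until rung 0 closes.
-/

set_option autoImplicit false
set_option linter.dupNamespace false -- the mandated namespace repeats `HodgeConjecture.HodgeConjecture`

noncomputable section


open scoped Matrix Topology ENNReal NNReal BigOperators ComplexConjugate
open NumberField IsDedekindDomain MeasureTheory Filter
open Literature.NumberTheory.Automorphic Literature.NumberTheory.GaloisRepresentations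
open Literature.NumberTheory.GelbartRogawski1991 Literature.NumberTheory.GelbartRogawski1991.GRConstruction Literature.NumberTheory.GelbartRogawski1991.AdaptedBlocks
open Literature.NumberTheory.K2Lit.SiegelDoubled Literature.MeasureTheory.Group
open Literature.NumberTheory.Automorphic.IdeleClassGroup

namespace Summit.HodgeConjecture.HodgeConjecture.Cruxes.HLiu418.K2LiuSiegelEisensteinContinuationTopTwentySocket

open K2LiuSiegelUnipotentFourierDefs K2LiuSiegelUnipotentLocalDefs K2LiuSiegelEisensteinContinuationTopKinds K2LiuSiegelEisensteinContinuationPoleSet K2LiuSiegelEisensteinConstantTermPackage K2LiuSiegelEisensteinConstantTermFiniteness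
open K2LiuSiegelEisensteinContinuationTopTwenty (siegelEisensteinContinuation_twenty_poleSet)

open Classical in
/-- **SOCKET #41 (edition 20, the socket form).**  Binders = ★ `siegelEisensteinContinuation_twenty_poleSet`'s VERBATIM; conclusion = socket #41's body BYTES VERBATIM
(`∃ P Es, (A1) ∧ (A2) ∧ (A3) ∧ (A4) ∧ (A5)`), from the pinned head with `P := {½}`. [cite: Tan1999, §1 Main Theorem; §4 Prop. 4.8] [cite: MoeglinWaldspurger1995, IV.1.8–IV.1.11]
[cite: Liu2021, Lem. B.10 (2), B.12] -/
theorem siegelEisensteinContinuation_twenty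
    (L : Type) [Field L] [NumberField L] [IsCMField L] {n : ℕ} (e : Fin 2 × Fin 1 ≃ Fin n)
    (dV : Fin 2 → L) (hdV : ∀ i, IsCMField.complexConj L (dV i) = dV i) (hdV0 : ∀ i, dV i ≠ 0)
    (dW : Fin 1 → L) (hdW : ∀ i, IsCMField.complexConj L (dW i) = dW i) (hdW0 : ∀ i, dW i ≠ 0)
    (lam : IdeleClassGroup L →ₜ* Circle) (hlam : IsConjugateSymplectic L lam) (hw : HasWeight L lam 1)
    (𝒦 : IwasawaDatum L e dV hdV dW hdW) (h𝒦 : 𝒦.IsStd) (f : ℂ → HA L e dV hdV dW hdW → ℂ)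
    (hstd : IsStandardSectionFamily 𝒦 (toHeckeCharacter L lam⁻¹) f) (hcont : ∀ s, Continuous (f s))
    -- the carrier (built by the tie as in ★ edition 2: Haar + ★ (C0) + ★ covering weight)
    [MeasurableSpace (unipDelta L e dV hdV dW hdW)] [BorelSpace (unipDelta L e dV hdV dW hdW)]
    (νN : Measure (unipDelta L e dV hdV dW hdW)) [νN.IsHaarMeasure]
    (β : unipDelta L e dV hdV dW hdW → ℝ≥0∞) (hβ : IsCoveringWeight (unipDeltaRat L e dV hdV dW hdW) β)
    (hβ0 : ∫⁻ u, β u ∂νN ≠ 0) (hβtop : ∫⁻ u, β u ∂νN ≠ ∞)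
    {K : Set (unipDelta L e dV hdV dW hdW)} (hK : IsCompact K) (hβK : ∀ u, β u ≤ K.indicator 1 u)
    -- KIND 0: rational Weyl presentation; big cell = ★ p861474's continuation letters `(S, hS, hur, E, hEd, hEeq)`; middle package
    (wq : unipDeltaRat L e dV hdV dW hdW → ratH L e dV hdV dW hdW)
    (hwq : ∀ ν, ((wq ν : ratH L e dV hdV dW hdW) : HA L e dV hdV dW hdW) = weylDelta L e dV hdV dW hdW * ((ν : unipDelta L e dV hdV dW hdW) : HA L e dV hdV dW hdW))
    {S : Set (HeightOneSpectrum (𝓞 ↥(maximalRealSubfield L)))} (hS : S.Finite) (hur : ∀ v ∉ S, (quadraticHeckeCharCM L).IsUnramifiedAt v)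
    -- KIND 0 big cell: ★ (β) END `K2LiuBigCellContinuation.exists_bigCell_continuation_cm` (K2Liu-p13) — ramification EXACTLY on `S` (`hram`) and THE ARCHIMEDEAN FACE BY VALUE ((E8) END, K2Liu-p11):
    -- for every standard datum, every (E6′) arch datum `(s₀, A)` and every `κ`, the arch block of the big cell is integrable on `1 < re s` with a holomorphic integral on `{0 < re}`
    (hram : ∀ v ∈ S, ¬ (quadraticHeckeCharCM L).IsUnramifiedAt v)
    (hArch : ∀ (𝒦' : IwasawaDatum L e dV hdV dW hdW), 𝒦'.IsStd →
      ∀ (s₀ : ℂ) (A : UnitaryGroup.arch (Fp L) L (IsCMField.complexConj L) (n + n) (hermD L e dV hdV dW hdW) → ℂ),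
        (∀ p : HA L e dV hdV dW hdW, IsSiegelDelta L e dV hdV dW hdW p → UnitaryGroup.finPart (Fp L) L (IsCMField.complexConj L) (n + n) (hermD L e dV hdV dW hdW) p = 1 →
          ∀ x : UnitaryGroup.arch (Fp L) L (IsCMField.complexConj L) (n + n) (hermD L e dV hdV dW hdW),
            A (UnitaryGroup.archPart (Fp L) L (IsCMField.complexConj L) (n + n) (hermD L e dV hdV dW hdW) p * x) = siegelDeltaCharacter L e dV hdV dW hdW (toHeckeCharacter L lam⁻¹) s₀ p * A x) →
        (∃ V : Submodule ℂ (UnitaryGroup.arch (Fp L) L (IsCMField.complexConj L) (n + n) (hermD L e dV hdV dW hdW) → ℂ), FiniteDimensional ℂ V ∧ A ∈ V ∧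
          ∀ a₀ : UnitaryGroup.arch (Fp L) L (IsCMField.complexConj L) (n + n) (hermD L e dV hdV dW hdW),
            (UnitaryGroup.archToAdelic (Fp L) L (IsCMField.complexConj L) (n + n) (hermD L e dV hdV dW hdW) a₀ : HA L e dV hdV dW hdW) ∈ 𝒦'.K → ∀ G ∈ V, (fun x => G (x * a₀)) ∈ V) →
        Continuous A →
        ∀ κ : HA L e dV hdV dW hdW, κ ∈ 𝒦'.K →
          ∀ {_ : MeasurableSpace ↥(unipDeltaArch L e dV hdV dW hdW)} [BorelSpace ↥(unipDeltaArch L e dV hdV dW hdW)]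
            (νinf : Measure ↥(unipDeltaArch L e dV hdV dW hdW)) [νinf.IsHaarMeasure] [SigmaFinite νinf],
            (∀ s : ℂ, 1 < s.re → Integrable (fun p : ↥(unipDeltaArch L e dV hdV dW hdW) =>
              ((modDelta L e dV hdV dW hdW (𝒦'.pPart (UnitaryGroup.archToAdelic (Fp L) L (IsCMField.complexConj L) (n + n) (hermD L e dV hdV dW hdW)
                  (UnitaryGroup.archPart (Fp L) L (IsCMField.complexConj L) (n + n) (hermD L e dV hdV dW hdW) (weylDelta L e dV hdV dW hdW) *
                    (p : UnitaryGroup.arch (Fp L) L (IsCMField.complexConj L) (n + n) (hermD L e dV hdV dW hdW)) *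
                    UnitaryGroup.archPart (Fp L) L (IsCMField.complexConj L) (n + n) (hermD L e dV hdV dW hdW) κ))) : ℝ) : ℂ) ^ (2 * (s - s₀)) *
                A (UnitaryGroup.archPart (Fp L) L (IsCMField.complexConj L) (n + n) (hermD L e dV hdV dW hdW) (weylDelta L e dV hdV dW hdW) *
                    (p : UnitaryGroup.arch (Fp L) L (IsCMField.complexConj L) (n + n) (hermD L e dV hdV dW hdW)) *
                    UnitaryGroup.archPart (Fp L) L (IsCMField.complexConj L) (n + n) (hermD L e dV hdV dW hdW) κ)) νinf) ∧
            ∃ Ea : ℂ → ℂ, DifferentiableOn ℂ Ea {s : ℂ | 0 < s.re} ∧ ∀ s : ℂ, 1 < s.re →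
              ∫ p : ↥(unipDeltaArch L e dV hdV dW hdW),
                ((modDelta L e dV hdV dW hdW (𝒦'.pPart (UnitaryGroup.archToAdelic (Fp L) L (IsCMField.complexConj L) (n + n) (hermD L e dV hdV dW hdW)
                  (UnitaryGroup.archPart (Fp L) L (IsCMField.complexConj L) (n + n) (hermD L e dV hdV dW hdW) (weylDelta L e dV hdV dW hdW) *
                    (p : UnitaryGroup.arch (Fp L) L (IsCMField.complexConj L) (n + n) (hermD L e dV hdV dW hdW)) *
                    UnitaryGroup.archPart (Fp L) L (IsCMField.complexConj L) (n + n) (hermD L e dV hdV dW hdW) κ))) : ℝ) : ℂ) ^ (2 * (s - s₀)) *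
                A (UnitaryGroup.archPart (Fp L) L (IsCMField.complexConj L) (n + n) (hermD L e dV hdV dW hdW) (weylDelta L e dV hdV dW hdW) *
                    (p : UnitaryGroup.arch (Fp L) L (IsCMField.complexConj L) (n + n) (hermD L e dV hdV dW hdW)) *
                    UnitaryGroup.archPart (Fp L) L (IsCMField.complexConj L) (n + n) (hermD L e dV hdV dW hdW) κ) ∂νinf = Ea s)
    -- KIND 0 middle term: ★ p862904 (K2E4-p11) I4 ED. 6 «ARCH-ADAPTED DATUM» — ONE LETTER, stated at the socket's generic `n` (`= 2`): ARCHIMEDEAN LEVI-ADAPTEDNESS of `𝒦`: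
    -- for every Levi chart `Λ : GL_n(𝔸_L) →* H(𝔸)` (block equation of ★ α3-2) and every `k ∈ K_{GL_n} = GL_n(𝒪̂_L)·K_∞`, the archimedean component of `Λ k` lies in `𝒦.K`
    -- (inhabited at the (R-c)-adapted datum: (T3-arch) ★ p862756 + LH4-p17 `K2LiuLeviChartArchCompactOfRecord`; transported by ★ p862487 (T) + ★ p862557 §5)
    (hadapt : ∀ (Λ : GL (Fin n) (AdeleRing (𝓞 L) L) →* HA L e dV hdV dW hdW),
      (∀ g : GL (Fin n) (AdeleRing (𝓞 L) L), blk L e dV hdV dW hdW (Λ g) =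
        cayR (AdeleRing (𝓞 L) L) (Fin n) * Matrix.fromBlocks (g : Matrix (Fin n) (Fin n) (AdeleRing (𝓞 L) L)) 0 0
          (((gramR L e dV hdV dW hdW).map ((algebraMap L (AdeleRing (𝓞 L) L)).comp (algebraMap (Fp L) L)))⁻¹ *
            (((g⁻¹ : GL (Fin n) (AdeleRing (𝓞 L) L)) : Matrix (Fin n) (Fin n) (AdeleRing (𝓞 L) L)).map
              (UnitaryGroup.conjAdele (Fp L) L (IsCMField.complexConj L)))ᵀ *
            (gramR L e dV hdV dW hdW).map ((algebraMap L (AdeleRing (𝓞 L) L)).comp (algebraMap (Fp L) L))) *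
          cayRinv (AdeleRing (𝓞 L) L) (Fin n)) →
      ∀ k : ↥(standardMaximalCompactGL n L),
        (UnitaryGroup.archToAdelic (Fp L) L (IsCMField.complexConj L) (n + n) (hermD L e dV hdV dW hdW)
          (UnitaryGroup.archPart (Fp L) L (IsCMField.complexConj L) (n + n) (hermD L e dV hdV dW hdW) (Λ (k : GL (Fin n) (AdeleRing (𝓞 L) L)))) :
            HA L e dV hdV dW hdW) ∈ 𝒦.K)
    -- KIND 1: THE LETTERS OF RECORD (★ p862409: `ι := Unit`, `a := 1`, `ρb := 1`, `ρa S s := (s − ½)⁻¹`, `G := 1`) — two ONE-FUNCTION packages, each: the function, its holomorphy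
    -- on `{0 < re}`, its PIN at THIS carrier `(νN, β)` on `{n∕2 < re s}` for rank-one `S`, (L-dec) height-form Gaussian decay in its own size `τ ≥ ‖S‖_∞`, (L-supp) support
    -- K1-b♮: the continued NORMALISED MIDDLE-CELL (line) term `Ebc` (`MID_S` with O41.4's rational Weyl presentation `wq`)
    (Ebc : skewMatrices ((IsCMField.complexConj L : L ≃ₐ[Fp L] L) : L →+* L) ((gramR L e dV hdV dW hdW).map (algebraMap (Fp L) L)) → ℂ → HA L e dV hdV dW hdW → ℂ)
    (hEbd : ∀ S x, DifferentiableOn ℂ (fun s => Ebc S s x) {s : ℂ | 0 < s.re})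
    (hEbc : ∀ S : skewMatrices ((IsCMField.complexConj L : L ≃ₐ[Fp L] L) : L →+* L) ((gramR L e dV hdV dW hdW).map (algebraMap (Fp L) L)),
      (S : Matrix (Fin n) (Fin n) L) ≠ 0 → (S : Matrix (Fin n) (Fin n) L).det = 0 → ∀ (s : ℂ) (h : HA L e dV hdV dW hdW), (n : ℝ) / 2 < s.re →
        ((∫⁻ u, β u ∂νN).toReal⁻¹ : ℝ) •
          (∫ u, (β u).toReal • (conj (unipDeltaChar L e dV hdV dW hdW (S : Matrix (Fin n) (Fin n) L) (u : HA L e dV hdV dW hdW) : ℂ) *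
            (∑' q : ↥(({Quotient.mk (MulAction.orbitRel (siegelDeltaRat L e dV hdV dW hdW) (ratH L e dV hdV dW hdW)) 1} ∪
              Set.range (fun ν : unipDeltaRat L e dV hdV dW hdW =>
                (Quotient.mk (MulAction.orbitRel (siegelDeltaRat L e dV hdV dW hdW) (ratH L e dV hdV dW hdW)) (wq ν) :
                  SiegelDeltaQuot L e dV hdV dW hdW)))ᶜ : Set (SiegelDeltaQuot L e dV hdV dW hdW)),
              f s ((((Quotient.out (q : SiegelDeltaQuot L e dV hdV dW hdW) : ratH L e dV hdV dW hdW) : HA L e dV hdV dW hdW)) *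
                ((u : HA L e dV hdV dW hdW) * h)))) ∂νN) = Ebc S s h)
    (τb : skewMatrices ((IsCMField.complexConj L : L ≃ₐ[Fp L] L) : L →+* L) ((gramR L e dV hdV dW hdW).map (algebraMap (Fp L) L)) → ℝ)
    (hτb : ∀ S : skewMatrices ((IsCMField.complexConj L : L ≃ₐ[Fp L] L) : L →+* L) ((gramR L e dV hdV dW hdW).map (algebraMap (Fp L) L)),
      ‖(fun i j => NumberField.mixedEmbedding L ((S : Matrix (Fin n) (Fin n) L) i j))‖ ≤ τb S) (Nb : ℕ)
    (hdecb : ∀ z : ℂ, 0 < z.re → ∃ C a c a' r : ℝ, 0 ≤ C ∧ 0 ≤ a ∧ 0 < c ∧ 0 ≤ a' ∧ 0 < r ∧ ∀ S (s : ℂ), dist s z < r → ∀ h : HA L e dV hdV dW hdW,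
      ‖Ebc S s h‖ ≤ C * adelicHeightGL (n + n) L (h : GL (Fin (n + n)) (AdeleRing (𝓞 L) L)) ^ a *
        (Real.exp (-(c * adelicHeightGL (n + n) L (h : GL (Fin (n + n)) (AdeleRing (𝓞 L) L)) ^ (-a') * τb S)) * (1 + τb S) ^ Nb))
    {Cb κb : ℝ} (hCb : 0 < Cb) (hκb : 0 ≤ κb)
    (hsuppb : ∀ S (s : ℂ) (h : HA L e dV hdV dW hdW), 0 < s.re → Ebc S s h ≠ 0 →
      ∃ D : ℕ, 1 ≤ D ∧ (D : ℝ) ≤ Cb * adelicHeightGL (n + n) L (h : GL (Fin (n + n)) (AdeleRing (𝓞 L) L)) ^ κb ∧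
        ∀ i j, IsIntegral ℤ ((D : L) * (S : Matrix (Fin n) (Fin n) L) i j))
    -- K1-a♮: the continued `(s − ½)·`NORMALISED WHITTAKER (singular) term `Eac`
    (Eac : skewMatrices ((IsCMField.complexConj L : L ≃ₐ[Fp L] L) : L →+* L) ((gramR L e dV hdV dW hdW).map (algebraMap (Fp L) L)) → ℂ → HA L e dV hdV dW hdW → ℂ)
    (hEad : ∀ S x, DifferentiableOn ℂ (fun s => Eac S s x) {s : ℂ | 0 < s.re})
    (hEac : ∀ S : skewMatrices ((IsCMField.complexConj L : L ≃ₐ[Fp L] L) : L →+* L) ((gramR L e dV hdV dW hdW).map (algebraMap (Fp L) L)),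
      (S : Matrix (Fin n) (Fin n) L) ≠ 0 → (S : Matrix (Fin n) (Fin n) L).det = 0 → ∀ (s : ℂ) (h : HA L e dV hdV dW hdW), (n : ℝ) / 2 < s.re →
        (s - 1 / 2) * (((∫⁻ u, β u ∂νN).toReal⁻¹ : ℝ) • whittakerDelta L e dV hdV dW hdW νN (S : Matrix (Fin n) (Fin n) L) (f s) h) = Eac S s h)
    (τa : skewMatrices ((IsCMField.complexConj L : L ≃ₐ[Fp L] L) : L →+* L) ((gramR L e dV hdV dW hdW).map (algebraMap (Fp L) L)) → ℝ)
    (hτa : ∀ S : skewMatrices ((IsCMField.complexConj L : L ≃ₐ[Fp L] L) : L →+* L) ((gramR L e dV hdV dW hdW).map (algebraMap (Fp L) L)),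
      ‖(fun i j => NumberField.mixedEmbedding L ((S : Matrix (Fin n) (Fin n) L) i j))‖ ≤ τa S) (Na : ℕ)
    (hdeca : ∀ z : ℂ, 0 < z.re → ∃ C a c a' r : ℝ, 0 ≤ C ∧ 0 ≤ a ∧ 0 < c ∧ 0 ≤ a' ∧ 0 < r ∧ ∀ S (s : ℂ), dist s z < r → ∀ h : HA L e dV hdV dW hdW,
      ‖Eac S s h‖ ≤ C * adelicHeightGL (n + n) L (h : GL (Fin (n + n)) (AdeleRing (𝓞 L) L)) ^ a *
        (Real.exp (-(c * adelicHeightGL (n + n) L (h : GL (Fin (n + n)) (AdeleRing (𝓞 L) L)) ^ (-a') * τa S)) * (1 + τa S) ^ Na))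
    {Ca κa : ℝ} (hCa : 0 < Ca) (hκa : 0 ≤ κa)
    (hsuppa : ∀ S (s : ℂ) (h : HA L e dV hdV dW hdW), 0 < s.re → Eac S s h ≠ 0 →
      ∃ D : ℕ, 1 ≤ D ∧ (D : ℝ) ≤ Ca * adelicHeightGL (n + n) L (h : GL (Fin (n + n)) (AdeleRing (𝓞 L) L)) ^ κa ∧
        ∀ i j, IsIntegral ℤ ((D : L) * (S : Matrix (Fin n) (Fin n) L) i j))
    -- KIND W: ★ p862137 (F0P2-p08 ∘ K2E4-p10) letters BY VALUE — Euler data `(A, U, hEuler)` at the Whittaker level, holomorphy `hAd`, and the three (W3) letters on `A`: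
    -- archimedean size `τ` with `hτ`, height-form Gaussian decay `hdec`, bounded-denominator support `hsupp`
    -- (W1) the EULER DATA by value: `T`-part `A` and exceptional place set `U(S,h) = D(S) ∪ T(S,h)`, with the Euler identity on `{n∕2 < re s}`
    (A : skewMatrices ((IsCMField.complexConj L : L ≃ₐ[Fp L] L) : L →+* L) ((gramR L e dV hdV dW hdW).map (algebraMap (Fp L) L)) → ℂ → HA L e dV hdV dW hdW → ℂ)
    (U : skewMatrices ((IsCMField.complexConj L : L ≃ₐ[Fp L] L) : L →+* L) ((gramR L e dV hdV dW hdW).map (algebraMap (Fp L) L)) → HA L e dV hdV dW hdW →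
      Set (HeightOneSpectrum (𝓞 ↥(maximalRealSubfield L))))
    (hEuler : ∀ S : skewMatrices ((IsCMField.complexConj L : L ≃ₐ[Fp L] L) : L →+* L) ((gramR L e dV hdV dW hdW).map (algebraMap (Fp L) L)),
      (S : Matrix (Fin n) (Fin n) L).det ≠ 0 → ∀ (s : ℂ) (h : HA L e dV hdV dW hdW), (n : ℝ) / 2 < s.re →
        whittakerDelta L e dV hdV dW hdW νN (S : Matrix (Fin n) (Fin n) L) (f s) h =
          A S s h * (partialStandardL (U S h) (fun _ => {1}) (2 * s + 1) *
            partialStandardL (U S h) (fun v => {(quadraticHeckeCharCM L).valueAtUniformizer v}) (2 * s + 2))⁻¹)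
    -- (W2) holomorphy of the `T`-part
    (hAd : ∀ S (h : HA L e dV hdV dW hdW), DifferentiableOn ℂ (fun s => A S s h) {s : ℂ | 0 < s.re})
    -- (W3) K2E4-p10 (g8)'s three letters on `A`
    (τ : skewMatrices ((IsCMField.complexConj L : L ≃ₐ[Fp L] L) : L →+* L) ((gramR L e dV hdV dW hdW).map (algebraMap (Fp L) L)) → ℝ)
    (hτ : ∀ S : skewMatrices ((IsCMField.complexConj L : L ≃ₐ[Fp L] L) : L →+* L) ((gramR L e dV hdV dW hdW).map (algebraMap (Fp L) L)),
      ‖(fun i j => NumberField.mixedEmbedding L ((S : Matrix (Fin n) (Fin n) L) i j))‖ ≤ τ S) (NW : ℕ)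
    (hdec : ∀ z : ℂ, 0 < z.re → ∃ C a c a' r : ℝ, 0 ≤ C ∧ 0 ≤ a ∧ 0 < c ∧ 0 ≤ a' ∧ 0 < r ∧ ∀ S (s : ℂ), dist s z < r → ∀ h : HA L e dV hdV dW hdW,
      ‖A S s h‖ ≤ C * adelicHeightGL (n + n) L (h : GL (Fin (n + n)) (AdeleRing (𝓞 L) L)) ^ a *
        (Real.exp (-(c * adelicHeightGL (n + n) L (h : GL (Fin (n + n)) (AdeleRing (𝓞 L) L)) ^ (-a') * τ S)) * (1 + τ S) ^ NW))
    {CW κ : ℝ} (hCW : 0 < CW) (hκ : 0 ≤ κ)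
    (hsupp : ∀ S (s : ℂ) (h : HA L e dV hdV dW hdW), 0 < s.re → A S s h ≠ 0 →
      ∃ D : ℕ, 1 ≤ D ∧ (D : ℝ) ≤ CW * adelicHeightGL (n + n) L (h : GL (Fin (n + n)) (AdeleRing (𝓞 L) L)) ^ κ ∧
        ∀ i j, IsIntegral ℤ ((D : L) * (S : Matrix (Fin n) (Fin n) L) i j)) :
    ∃ (P : Finset ℂ) (Es : ℂ → HA L e dV hdV dW hdW → ℂ),
      (∀ h : HA L e dV hdV dW hdW, DifferentiableOn ℂ (fun s => Es s h) {s : ℂ | 0 < s.re}) ∧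
      (∀ s : ℂ, 0 < s.re → Continuous (Es s)) ∧
      (∀ s : ℂ, 0 < s.re → ∀ (γ : ratH L e dV hdV dW hdW) (h : HA L e dV hdV dW hdW),
        Es s ((γ : HA L e dV hdV dW hdW) * h) = Es s h) ∧
      (∀ (s : ℂ) (h : HA L e dV hdV dW hdW), (n : ℝ) / 2 < s.re →
        Es s h = (∏ p ∈ P, (s - p)) * eisensteinFamilyDelta L e dV hdV dW hdW f s h) ∧
      (∀ z : ℂ, 0 < z.re → ∃ C A r : ℝ, 0 < r ∧ ∀ s : ℂ, dist s z < r → ∀ h : HA L e dV hdV dW hdW,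
        ‖Es s h‖ ≤ C * adelicHeightGL (n + n) L (h : GL (Fin (n + n)) (AdeleRing (𝓞 L) L)) ^ A) := by
  obtain ⟨Es, hEs⟩ := siegelEisensteinContinuation_twenty_poleSet L e dV hdV hdV0 dW hdW hdW0 lam hlam hw 𝒦 h𝒦 f hstd hcont νN β hβ hβ0 hβtop hK hβK wq hwq hS hur hram hArch hadapt Ebc hEbd hEbc τb hτb Nb hdecb hCb hκb hsuppb Eac hEad hEac τa hτa Na hdeca hCa hκa hsuppa A U hEuler hAd τ hτ NW hdec hCW hκ hsupp
  exact ⟨_, Es, hEs⟩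

end Summit.HodgeConjecture.HodgeConjecture.Cruxes.HLiu418.K2LiuSiegelEisensteinContinuationTopTwentySocket

end
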